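import Summits.HubbardSuperconductivity.HubbardSuperconductivity.Theorems.AnisotropyChordTransferFibre3TwoChannel

/-!
# Route `AnisotropyChord` / H0 rotor rung: PartN40 — CAPACITY SHIFT (Sherman–Morrison) PROVED for symmetric kernels, and REFUTED as typed

PORT PartN40 (`…Fibre3TwoChannel`, theory seat `hubbard-h0-rotor-theory-1` g21, memo 21 §324) types
`TwoChannel.CapacityShift : Prop` — `P₁[A + c·11ᵀ, Λ] = P₁[A, Λ − c]` for EVERY invertible `5 × 5` real matrix `A`.
* `capacityShift_of_isSymm` — the identity holds for SYMMETRIC `A` (the only case used downstream: the kernel matrices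
  `A = (a(p − q))` of memo §314/§324 are symmetric).  Proof: Sherman–Morrison `(A + cJ)⁻¹ = A⁻¹ − c·x xᵀ/(1 + cs)` with
  `x = A⁻¹1` (row sums = column sums by symmetry), `x' = x/(1 + cs)`, `s' = s/(1 + cs)`, then scalar algebra.
* `not_capacityShift` — AS TYPED (no symmetry hypothesis) the statement is FALSE: for `A = 1 + E₀₁` (so `A⁻¹ = 1 − E₀₁`, row
  sums `(0,1,1,1,1)`, column sums `(1,0,1,1,1)`), `c = 1`, `Λ = 1` the `(e₁,e₁)` entries are `−17/10 ≠ −3/2`.  LOCATED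
  OBSTRUCTION for the theory seat: `CapacityShift` (and its corollary shape `ChannelCapacities`) need `A.IsSymm`; repaired
  versions `capacityShift_of_isSymm` / `channelCapacities_of_isSymm` below.  Nothing else in PartN40 changes
  (`TwoChannelReduction` carries its own symmetry hypotheses).
Prover seat `hubbard-h0-rotor-p2` g0; helper for stmt-HubbardSuperconductivity-19089 (`--supports`, helper class).
WHAT THIS IS NOT: nothing here proves superconductivity in the Hubbard model; helper algebra of ONE conditional reduction
(rung 19089, HOLE₂(.75) far pairs).  Mathlib only; no sorry, no axioms.
-/

set_option linter.dupNamespace false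
namespace Summit.HubbardSuperconductivity.HubbardSuperconductivity.Theorems.AnisotropyChord.Transfer.Fibre3

namespace TwoChannel

open Matrix

/-- `A · x = 1` for `x = A⁻¹ 1` when `A` is invertible. -/
theorem mulVec_xvec (A : Matrix (Fin 5) (Fin 5) ℝ) (hA : IsUnit A.det) :
    A.mulVec (xvec A) = fun _ => 1 := by
  unfold xvec
  rw [Matrix.mulVec_mulVec, Matrix.mul_nonsing_inv _ hA, Matrix.one_mulVec]

/-- for symmetric `A`, the inverse is symmetric. -/
theorem inv_isSymm_of_isSymm (A : Matrix (Fin 5) (Fin 5) ℝ) (hs : A.IsSymm) : (A⁻¹).IsSymm := by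
  unfold Matrix.IsSymm at *
  rw [Matrix.transpose_nonsing_inv, hs]

/-- for symmetric `A`, the column sums of `A⁻¹` are the row sums `x = A⁻¹1`: `1ᵀ A⁻¹ = xᵀ`. -/
theorem one_vecMul_inv_of_isSymm (A : Matrix (Fin 5) (Fin 5) ℝ) (hs : A.IsSymm) :
    Matrix.vecMul (fun _ => (1 : ℝ)) A⁻¹ = xvec A := by
  have h := inv_isSymm_of_isSymm A hs
  rw [← Matrix.mulVec_transpose, h.eq]
  rfl

/-- `J5 = 1 1ᵀ` as an outer product. -/
theorem J5_eq_vecMulVec : J5 = Matrix.vecMulVec (fun _ => (1 : ℝ)) (fun _ => (1 : ℝ)) := by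
  ext i j
  simp [J5, Matrix.vecMulVec_apply]

/-- SHERMAN–MORRISON for the all-ones perturbation of a symmetric invertible matrix:
`(A + c·11ᵀ)⁻¹ = A⁻¹ − (c/(1 + c s)) · x xᵀ`, `x = A⁻¹1`, `s = 1ᵀA⁻¹1`. -/
theorem inv_add_smul_J5 (A : Matrix (Fin 5) (Fin 5) ℝ) (hs : A.IsSymm) (hA : IsUnit A.det) (c : ℝ)
    (h1 : 1 + c * svec A ≠ 0) :
    (A + c • J5)⁻¹ = A⁻¹ - (c / (1 + c * svec A)) • Matrix.vecMulVec (xvec A) (xvec A) := by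
  apply Matrix.inv_eq_right_inv
  have hx := mulVec_xvec A hA
  have hcol := one_vecMul_inv_of_isSymm A hs
  have hsdef : dotProduct (fun _ => (1 : ℝ)) (xvec A) = svec A := by
    simp [dotProduct, svec]
  rw [J5_eq_vecMulVec]
  rw [Matrix.add_mul, Matrix.mul_sub, Matrix.mul_sub, Matrix.mul_nonsing_inv _ hA, Matrix.mul_smul,
    Matrix.mul_smul, Matrix.mul_vecMulVec, hx, Matrix.smul_mul, Matrix.vecMulVec_mul, hcol,
    Matrix.smul_mul, Matrix.vecMulVec_mul_vecMulVec, hsdef]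
  -- 1 - k • V + (c • V - k • (c • vecMulVec 1 (s • x))) = 1, V = vecMulVec 1 x
  ext i j
  simp only [Matrix.sub_apply, Matrix.add_apply, Matrix.smul_apply, Matrix.vecMulVec_apply, Pi.smul_apply,
    smul_eq_mul]
  field_simp
  ring

/-- the harmonic-measure vector of the shifted kernel: `x' = x/(1 + cs)`. -/
theorem xvec_add_smul_J5 (A : Matrix (Fin 5) (Fin 5) ℝ) (hs : A.IsSymm) (hA : IsUnit A.det) (c : ℝ)
    (h1 : 1 + c * svec A ≠ 0) :
    xvec (A + c • J5) = fun i => xvec A i / (1 + c * svec A) := by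
  have hsdef : dotProduct (xvec A) (fun _ => (1 : ℝ)) = svec A := by
    simp [dotProduct, svec]
  unfold xvec
  rw [inv_add_smul_J5 A hs hA c h1, Matrix.sub_mulVec, Matrix.smul_mulVec, Matrix.vecMulVec_mulVec, hsdef]
  ext i
  simp only [xvec, Pi.sub_apply, Pi.smul_apply, smul_eq_mul, MulOpposite.smul_eq_mul_unop, MulOpposite.unop_op]
  field_simp
  ring

/-- `s' = s/(1 + cs)`. -/
theorem svec_add_smul_J5 (A : Matrix (Fin 5) (Fin 5) ℝ) (hs : A.IsSymm) (hA : IsUnit A.det) (c : ℝ)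
    (h1 : 1 + c * svec A ≠ 0) :
    svec (A + c • J5) = svec A / (1 + c * svec A) := by
  unfold svec
  rw [xvec_add_smul_J5 A hs hA c h1, Finset.sum_div]
  rfl

/-- ★ CAPACITY SHIFT for SYMMETRIC kernels (memo §324; the repaired form of `CapacityShift`):
`P₁[A + c·11ᵀ, Λ] = P₁[A, Λ − c]`. -/
theorem capacityShift_of_isSymm (A : Matrix (Fin 5) (Fin 5) ℝ) (hs : A.IsSymm) (c Λ : ℝ)
    (hA : IsUnit A.det) (h1 : 1 + c * svec A ≠ 0) (h2 : (Λ - c) * svec A - 1 ≠ 0) :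
    oneHoleP (A + c • J5) Λ = oneHoleP A (Λ - c) := by
  have hinv := inv_add_smul_J5 A hs hA c h1
  have hx := xvec_add_smul_J5 A hs hA c h1
  have hsv := svec_add_smul_J5 A hs hA c h1
  have h3 : Λ * (svec A / (1 + c * svec A)) - 1 = ((Λ - c) * svec A - 1) / (1 + c * svec A) := by
    rw [eq_div_iff h1, sub_mul, mul_assoc, div_mul_cancel₀ _ h1]
    ring
  ext i j
  simp only [oneHoleP, Matrix.of_apply, hinv, hx, hsv, Matrix.sub_apply, Matrix.smul_apply,
    Matrix.vecMulVec_apply, smul_eq_mul]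
  rw [h3, div_div_eq_mul_div]
  set D := (Λ - c) * svec A - 1 with hD
  set d := 1 + c * svec A with hd
  have hdD : d * Λ = c * D + Λ + c * d := by rw [hD, hd]; ring
  field_simp
  linear_combination (-(xvec A i.succ * xvec A j.succ)) * hdD

/-- the corollary shape with the symmetry hypotheses it needs (repaired `ChannelCapacities`): with `M = a(d)·J5 + E`,
the even / odd channels are one-hole problems with kernels `A₀ ± E` at capacities `C₊ = 2Λ − a(d)`, `C₋ = a(d)`. -/
theorem channelCapacities_of_isSymm (A₀ E : Matrix (Fin 5) (Fin 5) ℝ) (ad Λ : ℝ)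
    (hps : (A₀ + E).IsSymm) (hms : (A₀ - E).IsSymm)
    (hp : IsUnit (A₀ + E).det) (hm : IsUnit (A₀ - E).det)
    (h1 : 1 + ad * svec (A₀ + E) ≠ 0) (h2 : (2 * Λ - ad) * svec (A₀ + E) - 1 ≠ 0)
    (h3 : 1 + (-ad) * svec (A₀ - E) ≠ 0) (h4 : (0 - (-ad)) * svec (A₀ - E) - 1 ≠ 0) :
    oneHoleP (A₀ + E + ad • J5) (2 * Λ) = oneHoleP (A₀ + E) (2 * Λ - ad) ∧
      oneHoleP (A₀ - E + (-ad) • J5) 0 = oneHoleP (A₀ - E) ad := by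
  refine ⟨capacityShift_of_isSymm (A₀ + E) hps ad (2 * Λ) hp h1 h2, ?_⟩
  have := capacityShift_of_isSymm (A₀ - E) hms (-ad) 0 hm h3 h4
  simpa using this

/-! ## The typed (symmetry-free) statement is false -/

/-- the witness kernel `A = 1 + E₀₁` (not symmetric). -/
def Awit : Matrix (Fin 5) (Fin 5) ℝ := Matrix.of fun i j => if i = j then 1 else if i = 0 ∧ j = 1 then 1 else 0

/-- its inverse `1 − E₀₁`. -/
def AwitInv : Matrix (Fin 5) (Fin 5) ℝ :=
  Matrix.of fun i j => if i = j then 1 else if i = 0 ∧ j = 1 then -1 else 0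

/-- the inverse of `A + J5`: `(1 − E₀₁) − y zᵀ/5`, `y = (0,1,1,1,1)` (row sums of `A⁻¹`), `z = (1,0,1,1,1)` (column sums). -/
noncomputable def AwitJInv : Matrix (Fin 5) (Fin 5) ℝ :=
  AwitInv - (1 / 5 : ℝ) • Matrix.vecMulVec (fun i => if i = 0 then (0 : ℝ) else 1) (fun j => if j = 1 then (0 : ℝ) else 1)

/-- `A · (1 − E₀₁) = 1`. -/
theorem Awit_mul_AwitInv : Awit * AwitInv = 1 := by
  ext i j
  fin_cases i <;> fin_cases j <;>
    simp [Awit, AwitInv, Matrix.mul_apply, Fin.sum_univ_five]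

/-- `(A + J) · AwitJInv = 1` (Sherman–Morrison by hand). -/
theorem AwitJ_mul_AwitJInv : (Awit + J5) * AwitJInv = 1 := by
  ext i j
  fin_cases i <;> fin_cases j <;>
    simp [Awit, AwitJInv, AwitInv, J5, Matrix.mul_apply, Fin.sum_univ_five, Matrix.vecMulVec_apply] <;>
      norm_num

/-- `A⁻¹ = 1 − E₀₁`. -/
theorem Awit_inv : Awit⁻¹ = AwitInv := Matrix.inv_eq_right_inv Awit_mul_AwitInv

/-- `(A + J)⁻¹ = AwitJInv`. -/
theorem AwitJ_inv : (Awit + J5)⁻¹ = AwitJInv := Matrix.inv_eq_right_inv AwitJ_mul_AwitJInv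

/-- `A` is invertible. -/
theorem Awit_det_isUnit : IsUnit Awit.det := Matrix.isUnit_det_of_right_inverse Awit_mul_AwitInv

/-- `s(A) = 4`. -/
theorem svec_Awit : svec Awit = 4 := by
  simp [svec, xvec, Awit_inv, AwitInv, Matrix.mulVec, dotProduct, Fin.sum_univ_five]
  norm_num

/-- `x(A + J) = (0,1,1,1,1)/5`. -/
theorem xvec_AwitJ (i : Fin 5) : xvec (Awit + J5) i = if i = 0 then 0 else 1 / 5 := by
  fin_cases i <;>
    simp [xvec, AwitJ_inv, AwitJInv, AwitInv, Matrix.mulVec, dotProduct, Fin.sum_univ_five,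
      Matrix.vecMulVec_apply] <;> norm_num

/-- `s(A + J) = 4/5`. -/
theorem svec_AwitJ : svec (Awit + J5) = 4 / 5 := by
  simp [svec, xvec_AwitJ, Fin.sum_univ_five]
  norm_num

/-- ★ `CapacityShift` AS TYPED is false (witness `A = 1 + E₀₁`, `c = 1`, `Λ = 1`; the `(e₁,e₁)` entries are `−17/10` vs `−3/2`). -/
theorem not_capacityShift : ¬ CapacityShift := by
  intro h
  have h1 : (1 : ℝ) + 1 * svec Awit ≠ 0 := by rw [svec_Awit]; norm_num
  have h2 : ((1 : ℝ) - 1) * svec Awit - 1 ≠ 0 := by rw [svec_Awit]; norm_num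
  have key := h Awit 1 1 Awit_det_isUnit h1 h2
  rw [one_smul] at key
  have e := congrFun (congrFun key 0) 0
  simp only [oneHoleP, Matrix.of_apply, AwitJ_inv, Awit_inv, xvec_AwitJ, svec_AwitJ] at e
  simp [AwitJInv, AwitInv, Matrix.vecMulVec_apply, xvec, Awit_inv, Matrix.mulVec, dotProduct] at e
  norm_num at e

/-- ★ `ChannelCapacities` AS TYPED (no symmetry hypotheses) is false as well: with `E = 0`, `A₀ = 1 + E₀₁`, `a(d) = 1`,
`Λ = ½` its first conjunct is the `CapacityShift` witness instance (`P₁[A + J, 1] ≠ P₁[A, 0]`).  The repaired form is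
`channelCapacities_of_isSymm`. -/
theorem not_channelCapacities : ¬ ChannelCapacities := by
  intro h
  have hs : svec (Awit + 0) = 4 := by rw [add_zero, svec_Awit]
  have hs' : svec (Awit - 0) = 4 := by rw [sub_zero, svec_Awit]
  have hdet : IsUnit (Awit + 0).det := by rw [add_zero]; exact Awit_det_isUnit
  have hdet' : IsUnit (Awit - 0).det := by rw [sub_zero]; exact Awit_det_isUnit
  have h1 : (1 : ℝ) + 1 * svec (Awit + 0) ≠ 0 := by rw [hs]; norm_num
  have h2 : ((2 : ℝ) * (1 / 2) - 1) * svec (Awit + 0) - 1 ≠ 0 := by rw [hs]; norm_num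
  have h3 : (1 : ℝ) + (-1) * svec (Awit - 0) ≠ 0 := by rw [hs']; norm_num
  have h4 : ((0 : ℝ) - (-1)) * svec (Awit - 0) - 1 ≠ 0 := by rw [hs']; norm_num
  have key := (h Awit 0 1 (1 / 2) hdet hdet' h1 h2 h3 h4).1
  rw [add_zero, one_smul, show (2 : ℝ) * (1 / 2) = 1 by norm_num, show (1 : ℝ) - 1 = 0 by norm_num] at key
  have e := congrFun (congrFun key 0) 0
  simp only [oneHoleP, Matrix.of_apply, AwitJ_inv, Awit_inv, xvec_AwitJ, svec_AwitJ] at e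
  simp [AwitJInv, AwitInv, Matrix.vecMulVec_apply, xvec, Awit_inv, Matrix.mulVec, dotProduct] at e
  norm_num at e

end TwoChannel

end Summit.HubbardSuperconductivity.HubbardSuperconductivity.Theorems.AnisotropyChord.Transfer.Fibre3
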